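import Summits.BirchSwinnertonDyer.BirchSwinnertonDyer.Theorems.UniversalToricDescentSigmaPassage
import Summits.BirchSwinnertonDyer.BirchSwinnertonDyer.Theorems.CumulativeHeegnerLeopoldtCumulativeHeegnerInclusionAtThreeBadPlacesSplitFinite
import Literature.NumberTheory.EllipticCurves.AnticyclotomicHeegnerPlacesDecompositionProofs
import Literature.NumberTheory.DiophantineGeometry.LocalReductionFiniteBadPlacesProofs
import HarnessLib

/-!
# The `Σ₀`-PASSAGE of the residual link: `R_{𝔭′}^{Σ₀}(K_∞, E′[p])` finite ⟹ `Sel_{𝔭′}^∅(K_∞, E′[p^∞])[p]` finite, with `Σ₀` = the bad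
# places of `E′_K` prime to `p`, which are finitely many, tame and finitely decomposed in the anticyclotomic tower
# (end-game of the port stub `stub_residualLinkMult`, line `beta-road` v5 on crux `TwinAlgMuZeroAtThree`, stmt-BirchSwinnertonDyer-24737)

Width prover `bsd-wall-utd-p1-w2` g9 under lead `bsd-wall-utd-p1` g23 (`--supports stmt-BirchSwinnertonDyer-24737`, helper; the lead's
SPLIT OFFER 20:05:54Z «Σ₀-PASSAGE»). THEOREMS ONLY (no definition, no named fact, no `sorry`). BSD is not proved by any of this.

Setting (crux binders, any prime `p`): `E′ = W′/ℚ` elliptic of conductor `N′`, `K` imaginary quadratic satisfying the Heegner hypothesis for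
`N′`, `κ` the anticyclotomic `ℤ_p`-extension, `𝔭′ ∋ p` a place of `K`. `Σ₀` := a finset of places of `K` with
`v ∈ Σ₀ ↔ (p ∉ v ∧ E′_K has bad reduction at v)` (it exists: `exists_sigma0`, the bad places are finite — tree `finite_badPlaces_holds`).

* §1 **`exists_sigma0`** — such a `Σ₀` exists, and (`sigma0_tame`, `sigma0_hasGoodReductionAt`, **`sigma0_decomp_not_le`**) every
  `v ∈ Σ₀` is tame, `E′_K` has good reduction at every `v ∉ Σ₀` prime to `p`, and every `v ∈ Σ₀` is FINITELY DECOMPOSED in `K_∞`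
  (`D_v ⊄ Gal(K̄/K_∞)`): a bad place of `E′_K` lies over a rational prime `ℓ ∣ N′` (Silverman VII.5.4 (b), tree
  `…CumulativeHeegnerInclusionAtThreeBadPlaces.exists_prime_mem_dvd_conductorNorm_of_not_hasGoodReductionAt`), hence contains `N′`, and such
  places are finitely decomposed by the Heegner hypothesis and Brink's theorem (tree
  `ZpExtension.decomp_not_le_kerSubgroup_of_natCast_mem_of_satisfiesHeegnerHypothesis`). These are exactly the inputs of the width seat's
  `…LayerLocalFactors.exists_forall_card_placesOver_le` / `exists_forall_prod_natCard_kummerSelmerStructure_le_pow` (uniform tame local factor).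
* §2 **`finite_selmerAc_pTorsion_empty_of_finite_residual`** — for ANY set `S` off which (and off `p`) `E′_K` has good reduction:
  `R_{𝔭′}^{S}(K_∞, E′[p]) = datumStrictSelmer (ker κ) E′_K[p] p (bdpData 𝔭′) S` finite ⟹ `{s ∈ Sel_{𝔭′}^∅(K_∞, E′_K[p^∞]) : p s = 0}` finite
  (g6 `…ResidualSelmerFinite.finite_selmerAc_pTorsion_of_finite_residualSelmer`, which needs `D_{𝔭′} ⊄ ker κ` — Brink's Cor. 1, tree
  `ZpExtension.decomp_not_le_kerSubgroup_above_of_isAnticyclotomic_anyPrime` — then the `Σ → ∅` passage `…SigmaPassage.finite_selmerAc_pTorsion_empty_of`);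
  **`finite_selmerAc_pTorsion_empty_of_finite_residual_sigma0`** — the same at `S = ↑Σ₀` with the good-reduction side condition discharged.

References: [Brink2007] Thm. 2, Cor. 1 (p. 2136); [GrossLMS1991] §1 (Heegner hypothesis); [SilvermanAEC2009] Prop. VII.5.4 (b);
[GreenbergLNM1716] §3 Lemmas 3.1–3.3; [LimSujatha2018] §3; [Castella2018] Def. 2.2.
-/

set_option linter.dupNamespace false
set_option autoImplicit false

noncomputable section
open scoped Classical

namespace Summit.BirchSwinnertonDyer.BirchSwinnertonDyer.Theorems.UniversalToricDescentResidualLinkSigmaPassage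

open NumberField IsDedekindDomain Field WeierstrassCurve
open Literature.NumberTheory.EllipticCurves Literature.NumberTheory.EllipticCurves.GreenbergSelmer
  Literature.NumberTheory.EllipticCurves.GreenbergVatsal2000 Literature.NumberTheory.GaloisRepresentations
open Summit.BirchSwinnertonDyer.Rank1Residual.X11b Summit.BirchSwinnertonDyer.Rank1Residual.X11b.AcSelmer
open Summit.BirchSwinnertonDyer.BirchSwinnertonDyer.Theorems.UniversalToricDescentResidualSelmerFinite
  Summit.BirchSwinnertonDyer.BirchSwinnertonDyer.Theorems.UniversalToricDescentSigmaPassage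
  Summit.BirchSwinnertonDyer.BirchSwinnertonDyer.Theorems.CumulativeHeegnerInclusionAtThreeBadPlaces

variable (W' : WeierstrassCurve ℚ) [W'.IsElliptic] {N' : ℕ} [NeZero N'] (K : Type) [Field K] [NumberField K]
  (p : ℕ) [Fact p.Prime]

/-! ## §1 The finite set `Σ₀` of bad places of `E′_K` prime to `p` -/

omit [NeZero N'] [Fact p.Prime] in
/-- **`Σ₀` exists**: the places `v ∌ p` of `K` at which `E′_K = W′.baseChange K` has bad reduction form a finset (the bad places of an
elliptic curve over a number field are finite, tree `finite_badPlaces_holds`). [cite: SilvermanAEC2009, VII.5 and VIII.8 (finitely many bad places)] -/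
theorem exists_sigma0 :
    ∃ S₀ : Finset (HeightOneSpectrum (𝓞 K)), ∀ v, v ∈ S₀ ↔
      (((p : ℕ) : 𝓞 K) ∉ v.asIdeal ∧ ¬ (W'.baseChange K).HasGoodReductionAt v) := by
  have hfin : ((W'.baseChange K).badPlaces (𝓞 K)).Finite := (W'.baseChange K).finite_badPlaces_holds (𝓞 K)
  have hsub : {v : HeightOneSpectrum (𝓞 K) | ((p : ℕ) : 𝓞 K) ∉ v.asIdeal ∧ ¬ (W'.baseChange K).HasGoodReductionAt v} ⊆
      (W'.baseChange K).badPlaces (𝓞 K) := fun v hv ↦ (mem_badPlaces_iff _ v).mpr hv.2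
  exact ⟨(hfin.subset hsub).toFinset, fun v ↦ by rw [Set.Finite.mem_toFinset, Set.mem_setOf_eq]⟩

variable {W' K p}

omit [W'.IsElliptic] [NeZero N'] [Fact p.Prime] in
/-- Every place of `Σ₀` is tame (`p ∉ v`). [folklore] -/
theorem sigma0_tame {S₀ : Finset (HeightOneSpectrum (𝓞 K))}
    (hS₀ : ∀ v, v ∈ S₀ ↔ (((p : ℕ) : 𝓞 K) ∉ v.asIdeal ∧ ¬ (W'.baseChange K).HasGoodReductionAt v)) :
    ∀ v ∈ S₀, ((p : ℕ) : 𝓞 K) ∉ v.asIdeal := fun v hv ↦ ((hS₀ v).mp hv).1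

omit [W'.IsElliptic] [NeZero N'] [Fact p.Prime] in
/-- Off `Σ₀` and off `p`, `E′_K` has good reduction (the side condition `hS` of
`…ResidualSelmerFinite.finite_selmerAc_pTorsion_of_finite_residualSelmer`). [folklore] -/
theorem sigma0_hasGoodReductionAt {S₀ : Finset (HeightOneSpectrum (𝓞 K))}
    (hS₀ : ∀ v, v ∈ S₀ ↔ (((p : ℕ) : 𝓞 K) ∉ v.asIdeal ∧ ¬ (W'.baseChange K).HasGoodReductionAt v)) :
    ∀ v : HeightOneSpectrum (𝓞 K), v ∉ (S₀ : Set (HeightOneSpectrum (𝓞 K))) → ((p : ℕ) : 𝓞 K) ∉ v.asIdeal →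
      (W'.baseChange K).HasGoodReductionAt v := by
  intro v hv hpv
  by_contra hbad
  exact hv (Finset.mem_coe.mpr ((hS₀ v).mpr ⟨hpv, hbad⟩))

omit [Fact p.Prime] in
/-- **Every place of `Σ₀` is finitely decomposed in the anticyclotomic tower** (`D_v ⊄ Gal(K̄/K_∞)`): a bad place `v` of `E′_K` lies over a
rational prime `ℓ ∣ N′` (good reduction is preserved by base change, Silverman VII.5.4 (b)), so `N′ ∈ v`; a place `v ∌ p`, `v ∋ N′` of a Heegner
field for `N′` has degree one and Brink's theorem applies. [cite: Brink2007, Thm. 2 and Cor. 1] [cite: GrossLMS1991, §1]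
[cite: SilvermanAEC2009, Prop. VII.5.4 (b)] -/
theorem sigma0_decomp_not_le [Fact p.Prime] (hN : W'.conductorNorm ℤ = N') (hK : IsImaginaryQuadratic K)
    (hH : SatisfiesHeegnerHypothesis N' K) (κ : ZpExtension K p) (hκ : κ.IsAnticyclotomic)
    {S₀ : Finset (HeightOneSpectrum (𝓞 K))}
    (hS₀ : ∀ v, v ∈ S₀ ↔ (((p : ℕ) : 𝓞 K) ∉ v.asIdeal ∧ ¬ (W'.baseChange K).HasGoodReductionAt v)) :
    ∀ v ∈ S₀, ¬ (decomp v ≤ κ.kerSubgroup) := by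
  intro v hv
  obtain ⟨hpv, hbad⟩ := (hS₀ v).mp hv
  obtain ⟨ℓ, -, hℓv, hℓN⟩ := exists_prime_mem_dvd_conductorNorm_of_not_hasGoodReductionAt W' K v hbad
  rw [hN] at hℓN
  obtain ⟨m, hm⟩ := hℓN
  have hNv : ((N' : ℕ) : 𝓞 K) ∈ v.asIdeal := by
    rw [hm, Nat.cast_mul]
    exact v.asIdeal.mul_mem_right _ hℓv
  exact ZpExtension.decomp_not_le_kerSubgroup_of_natCast_mem_of_satisfiesHeegnerHypothesis hK κ hκ hH (NeZero.ne N') v hpv hNv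

/-- **`Σ₀` packaged**: a finset `Σ₀` of tame places of `K`, each finitely decomposed in `K_∞`, off which (and off `p`) `E′_K` has good
reduction — exactly the inputs of `…LayerLocalFactors.exists_forall_card_placesOver_le` and of §2 below.
[cite: Brink2007, Cor. 1] [cite: GrossLMS1991, §1] [cite: SilvermanAEC2009, Prop. VII.5.4 (b)] -/
theorem exists_sigma0_package (hN : W'.conductorNorm ℤ = N') (hK : IsImaginaryQuadratic K)
    (hH : SatisfiesHeegnerHypothesis N' K) (κ : ZpExtension K p) (hκ : κ.IsAnticyclotomic) :
    ∃ S₀ : Finset (HeightOneSpectrum (𝓞 K)),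
      (∀ v, v ∈ S₀ ↔ (((p : ℕ) : 𝓞 K) ∉ v.asIdeal ∧ ¬ (W'.baseChange K).HasGoodReductionAt v)) ∧
      (∀ v ∈ S₀, ((p : ℕ) : 𝓞 K) ∉ v.asIdeal) ∧
      (∀ v ∈ S₀, ¬ (decomp v ≤ κ.kerSubgroup)) ∧
      (∀ v : HeightOneSpectrum (𝓞 K), v ∉ (S₀ : Set (HeightOneSpectrum (𝓞 K))) → ((p : ℕ) : 𝓞 K) ∉ v.asIdeal →
        (W'.baseChange K).HasGoodReductionAt v) := by
  obtain ⟨S₀, hS₀⟩ := exists_sigma0 W' K p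
  exact ⟨S₀, hS₀, sigma0_tame hS₀, sigma0_decomp_not_le hN hK hH κ hκ hS₀, sigma0_hasGoodReductionAt hS₀⟩

/-! ## §2 `R_{𝔭′}^{S}(K_∞, E′_K[p])` finite ⟹ `Sel_{𝔭′}^∅(K_∞, E′_K[p^∞])[p]` finite -/

/-- **The `Σ₀`-passage, general `S`.** For `K` imaginary quadratic, `κ` anticyclotomic, `𝔭′ ∋ p`, and ANY set `S` of places off which
(and off `p`) `E′_K` has good reduction: if the residual group `R_{𝔭′}^{S}(K_∞, E′_K[p])` is finite then so is
`{s ∈ Sel_{𝔭′}^∅(K_∞, E′_K[p^∞]) : p s = 0}`. (`D_{𝔭′} ⊄ ker κ` by Brink's Cor. 1; g6's receptacle gives `Sel_{𝔭′}^{S}[p]` finite; then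
`Sel^∅ ≤ Sel^S`.) [cite: Brink2007, Cor. 1 (p. 2136)] [cite: LimSujatha2018, §3 (proof of Prop. 3.2)] [cite: GreenbergLNM1716, §3 Lemmas 3.1–3.3]
[cite: Castella2018, Def. 2.2 (arXiv:1704.06608 p. 5)] -/
theorem finite_selmerAc_pTorsion_empty_of_finite_residual (hK : IsImaginaryQuadratic K)
    (κ : ZpExtension K p) (hκ : κ.IsAnticyclotomic)
    (𝔭' : HeightOneSpectrum (𝓞 K)) (h𝔭' : ((p : ℕ) : 𝓞 K) ∈ 𝔭'.asIdeal)
    {S : Set (HeightOneSpectrum (𝓞 K))}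
    (hS : ∀ v : HeightOneSpectrum (𝓞 K), v ∉ S → ((p : ℕ) : 𝓞 K) ∉ v.asIdeal → (W'.baseChange K).HasGoodReductionAt v)
    (hfin : (datumStrictSelmer κ.kerSubgroup ((W'.baseChange K).geomTorsion (p : ℤ)) p
        (AcSelmer.bdpData _ p 𝔭') S :
        Set (Literature.NumberTheory.EllipticCurves.subgroupH1 κ.kerSubgroup ((W'.baseChange K).geomTorsion (p : ℤ)))).Finite) :
    Set.Finite {s : selmerAc (W'.baseChange K) p κ 𝔭' ∅ | p • s = 0} := by
  have h𝔭dec : ¬ (decomp 𝔭' ≤ κ.kerSubgroup) :=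
    ZpExtension.decomp_not_le_kerSubgroup_above_of_isAnticyclotomic_anyPrime K p hK κ hκ 𝔭' h𝔭'
  exact finite_selmerAc_pTorsion_empty_of (W'.baseChange K) κ
    (finite_selmerAc_pTorsion_of_finite_residualSelmer (W'.baseChange K) κ h𝔭' h𝔭dec hS hfin)

/-- **The `Σ₀`-passage at `S = Σ₀`** (the bad places of `E′_K` prime to `p`): the good-reduction side condition is automatic.
[cite: Brink2007, Cor. 1 (p. 2136)] [cite: LimSujatha2018, §3] [cite: GreenbergLNM1716, §3 Lemmas 3.1–3.3] -/
theorem finite_selmerAc_pTorsion_empty_of_finite_residual_sigma0 (hK : IsImaginaryQuadratic K)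
    (κ : ZpExtension K p) (hκ : κ.IsAnticyclotomic)
    (𝔭' : HeightOneSpectrum (𝓞 K)) (h𝔭' : ((p : ℕ) : 𝓞 K) ∈ 𝔭'.asIdeal)
    {S₀ : Finset (HeightOneSpectrum (𝓞 K))}
    (hS₀ : ∀ v, v ∈ S₀ ↔ (((p : ℕ) : 𝓞 K) ∉ v.asIdeal ∧ ¬ (W'.baseChange K).HasGoodReductionAt v))
    (hfin : (datumStrictSelmer κ.kerSubgroup ((W'.baseChange K).geomTorsion (p : ℤ)) p
        (AcSelmer.bdpData _ p 𝔭') (S₀ : Set (HeightOneSpectrum (𝓞 K))) :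
        Set (Literature.NumberTheory.EllipticCurves.subgroupH1 κ.kerSubgroup ((W'.baseChange K).geomTorsion (p : ℤ)))).Finite) :
    Set.Finite {s : selmerAc (W'.baseChange K) p κ 𝔭' ∅ | p • s = 0} :=
  finite_selmerAc_pTorsion_empty_of_finite_residual hK κ hκ 𝔭' h𝔭' (sigma0_hasGoodReductionAt hS₀) hfin

end Summit.BirchSwinnertonDyer.BirchSwinnertonDyer.Theorems.UniversalToricDescentResidualLinkSigmaPassage

end
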